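import Summits.QuantumFields.YangMills.Theorems.UnitScaleTiltProp7SectET3DeltaOneT3SlotRealityRows
import Summits.QuantumFields.YangMills.Theorems.UnitScaleTiltProp7SectET3DeltaPiTpairSymmT3
import Summits.QuantumFields.YangMills.Theorems.UnitScaleTiltProp7WilsonHessianSectorRows
import Summits.QuantumFields.YangMills.Theorems.UnitScaleTiltProp7SectET3WilsonHessianT3SigmaRows
import Summits.QuantumFields.YangMills.Theorems.UnitScaleTiltProp7SectET3RealityPInvT3
import Literature.MathematicalPhysics.QuantumFieldTheory.Balaban1983to89.B9Eq3119DeltaPiCarrier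
import HarnessLib

/-!
# Route `UnitScaleTilt`, crux K1 child «MinimiserStabilityRegPr» (stmt-QuantumFields-19200), stub `stub_existenceMinimalOrbit` (EX), route (α) —
# «SLOT-CURRENT-ROWS» (GENERIC IN THE HESSIAN SLOT, EX namer ★w2-19200 g6 standing instruction (D) 2026-08-28T20:46:09Z): **THE TWO LETTER ROWS OF THE (W-X′) CURRENT LETTER
# `Δ̃ := currentCLM frobEquiv lev₁ Dc (Δx U₀)` — the (63) symmetry binder `hΔ` and the (R-W) sector row `hΔπ` — FROM THE SLOT'S OWN ROWS (`hΔsymm`, σ-row `hΔx`, traceless row `hΔtr`),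
# with one-line instances at `Δx := DeltaPiSlot` (on `RegPr`) and `Δx := DeltaEtaSlot` (unconditional)**

Cell `ym3-torus`, width seat `ym3-torus-px14` (gen 2; LOCATE «WF-LETTERS» `ym3-torus-px14/LOCATE-WF-LETTERS-px14g2.md` §3; offer «DELTAPI-CURRENT-REALITY» 20:19Z RE-CUT generic per (D)).
THEOREMS ONLY (0 `def`, 0 `sorry`).  `--supports stmt-QuantumFields-19200 --as helper`, count-neutral.  YM₃ on T³ is a ladder rung (R3), not the Clay problem; nothing here claims the stub,
the crux, d = 4 or the mass gap.

THE PRINT.  [Balaban1985Variational] (27) p. 282 (the pairing), (51) p. 286 «for A′ with values in 𝔤 the configuration D(A′) has values in 𝔤 also», (80) p. 290 (the `½⟨HD(A′), Δ_π HD(A′)⟩`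
term — `Δ_π` enters through a QUADRATIC FORM, hence symmetric for the bilinear pairing), (84)–(89) pp. 290–291; [Balaban1985BackgroundPropagators] p. 393 «The operators … are real»,
(3.118)–(3.119) p. 419.  WHY GENERIC (namer 20:46:09Z, display defect №5: `PosPrime` is empty, the Hessian slot of record will flip from `DeltaPiSlot` to a pseudo-inverse twin
`DeltaPiSlotP`): every row about the slot is to be stated for a VARIABLE slot `Δx : ∀ U₀, BondL2K … →ₗ[ℂ] BondL2K …` with its slot rows displayed, `DeltaPiSlot`-specific corollaries
as one-line instances — so the SAME theorems serve today's letter and the flipped one.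

WHAT IS PROVED (sorry-free; no definition).  For ANY slot `Δx` at a background `U₀`, `Δ̃ := currentCLM frobEquiv lev₁ Dc (Δx U₀)` (lit's lattice-generic (115)→(−3) reader,
✓`B9Eq3119DeltaPiCarrier.currentCLM`), with `σ f := toL2 (star (toL2⁻¹ f))` the cell's conjugation and `ι Y := fun b′ ↦ JetSup.equiv _ _ _ Y (bondEquiv F K b′)`:
* §1 READING: `funEquiv_symm_flat115_eq_toL2`, **`equiv_currentCLM_slot`** — `NegSup.equiv (Δ̃ Y) b = (toL2⁻¹ (Δx U₀ (toL2 (ι Y)))) (bondEquiv⁻¹ b)`.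
* §2 (63)-SYMMETRY, GENERIC: ★`tpair_slot_comm (hΔsymm : (Δx U₀).IsSymmetric) (hΔx : ∀ f, Δx U₀ (σ f) = σ (Δx U₀ f))` — `(x, Δx y) = (y, Δx x)` for lit's bilinear `tpair frobEquiv τ`
  (norming `hφ`); ★★**`hΔ_currentCLM_slot`** — `pair27 τ (Δ̃ Y) (flat115 Z) = pair27 τ (Δ̃ Z) (flat115 Y)` = the `hΔ` binder of ✓`pair27_W80_zpow` VERBATIM (tracial `τ`), every `L η lev₀ lev₁ κ′ Dc`.
* §3 (R-W) SECTOR, GENERIC: ★`slot_toL2_isHermitian_traceless (hΔx) (hΔtr)` — Hermitian traceless `A` ↦ Hermitian traceless `toL2⁻¹ (Δx U₀ (toL2 A))`;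
  ★★**`currentCLM_slot_isHermitian_traceless (hΔx) (hΔtr)`** — S9's `hWR` currency for `Δ̃`; ★`currentCLM_slot_mem` — lit ✓`W80_apply_mem`'s `hΔπ` binder VERBATIM at `Δπ := Δ̃`
  (any `ℝ`-submodule `S` characterised by «Hermitian ∧ traceless»).
* §4 INSTANCES (one line each): at `Δx := DeltaEtaSlot` UNCONDITIONALLY (`hΔsymm` ✓`DeltaEta_isSymmetric`, `hΔx` ✓`DeltaEta_toL2_star`∕`DeltaEta_star_comm`, `hΔtr` ✓`trace_DeltaEta_toL2_eq_zero`):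
  `hΔ_currentCLM_DeltaEtaSlot`, `currentCLM_DeltaEtaSlot_isHermitian_traceless`; at `Δx := DeltaPiSlot` on `RegPr F n K ε₀ U₀` in the windows `10⁹L²e ≤ 1`, `10¹²L³ε₀ ≤ 1`, NO other row
  (`hΔx` ✓`DeltaOne_toL2_star_of_regPr`, `hΔtr` ✓`trace_DeltaOne_toL2_eq_zero_of_regPr` at `T_J := 0` via ✓`DeltaOne_zero`; `hQ` by the UNCONDITIONAL ✓`QTwS_star_comm_of_regPr`):
  `DeltaPiSlot_rows_of_regPr`, ★★`hΔ_currentCLM_DeltaPiSlot_of_regPr'` (supersedes ✓p663055's `…_of_regPr`, whose (Q-b)ʳ row `hscR` is superfluous), ★★`currentCLM_DeltaPiSlot_isHermitian_traceless_of_regPr`;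
  and §5 at THE PINV SLOT OF RECORD `Δx := DeltaPiSlotP` (✓p667715) on `RegPr`, `0 ≤ a`, NO other row (`hΔsymm` ✓`DeltaPiP_isSymmetric`, `hΔx`∕`hΔtr` ★px3's ✓`Prop7SectET3RealityPInv.DeltaPiSlotP_toL2_star_of_regPr`∕
  `trace_DeltaPiSlotP_toL2_eq_zero_of_regPr`): ★★★`hΔ_currentCLM_DeltaPiSlotP_of_regPr`, ★★★`currentCLM_DeltaPiSlotP_isHermitian_traceless_of_regPr` — the two letter rows of the FLIPPED (W-X′) `Δ̃π`.
HONEST SCOPE.  Linear algebra over landed letters; no estimate; no positivity (Thm 3.11) row; under defect №5 today's `DeltaPiSlot` coincides with `DeltaEtaSlot` (`G′ = 0` off the empty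
class) — the generic rows are indifferent to that and will instantiate at `DeltaPiSlotP` from ITS three slot rows when they land.

References: T. Bałaban, CMP 102 (1985) 277–309 [Balaban1985Variational] ((27) p.282, (51) p.286, (63) p.287, (80) p.290, (84)–(89) pp.290–291, (115) p.294); CMP 99 (1985) 389–434
[Balaban1985BackgroundPropagators] ((3.11) p.392, p.393, (3.118)–(3.119) p.419).
-/

set_option autoImplicit false

noncomputable section

open scoped InnerProductSpace ComplexConjugate Matrix.Norms.L2Operator BigOperators

namespace Summit.QuantumFields.YangMills.Theorems.Prop7SectET3SlotCurrentRows

open Literature.MathematicalPhysics.QuantumFieldTheory.Balaban1983to89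
open Literature.MathematicalPhysics.QuantumFieldTheory.Balaban1983to89.T3ContinuumYM3Torus
open Literature.MathematicalPhysics.QuantumFieldTheory.Balaban1983to89.B9Eq311TracePairing (tpair tpair_eq_inner_starW)
open Literature.MathematicalPhysics.QuantumFieldTheory.Balaban1983to89.B9Eq3119DeltaPiCarrier (currentCLM equiv_currentCLM pairSum_currentCLM_comm)
open Literature.MathematicalPhysics.QuantumFieldTheory.Balaban1983to89.B11Eq90Transpose (pair27 pair27_eq_sum)
open Literature.MathematicalPhysics.QuantumFieldTheory.Balaban1983to89.B11Eq90V0primeCurrent (flat115 flat115_apply)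
open T3PrintedRegularMinimiser (RegPr)
open B9SectCLatticeCarrier (Bond)
open B9Eq311L2Pairing (WL2)
open B11Eq103H1Complex (BondL2K funEquiv funEquiv_symm_apply)
open B11Eq115Space (NegSup NegSize Space115 JetSup levWeight)
open B11Eq111FrakG (nabla115)
open Summit.QuantumFields.YangMills.Theorems.Prop7SectET3Transport (periodsT3 bondEquiv bgOfCfg)
open Summit.QuantumFields.YangMills.Theorems.Prop7SectET3HilbertLetters (W₂ frobEquiv toL2 toL2_apply toL2_symm_apply)
open Summit.QuantumFields.YangMills.Theorems.Prop7SectET3HilbertLettersReality (inner_toL2_star toL2_star_star)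
open Summit.QuantumFields.YangMills.Theorems.Prop7SectET3WilsonHessian (DeltaEta DeltaEtaSlot DeltaEtaSlot_apply DeltaEta_isSymmetric DeltaEta_toL2_star)
open Summit.QuantumFields.YangMills.Theorems.Prop7WilsonHessianSectorRows (trace_DeltaEta_toL2_eq_zero)
open Summit.QuantumFields.YangMills.Theorems.Prop7SectET3DeltaPi (DeltaPiSlot)
open Summit.QuantumFields.YangMills.Theorems.Prop7SectET3DeltaOne (DeltaOne DeltaOne_zero DeltaPiSlot_isSymmetric DeltaOne_toL2_star_of_regPr trace_DeltaOne_toL2_eq_zero_of_regPr)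
open Summit.QuantumFields.YangMills.Theorems.Prop7SymAvgTwSym (QTwS_star_comm_of_regPr)
open Summit.QuantumFields.YangMills.Theorems.Prop7SectET3DeltaPiTpairSymm (starW_frobEquiv_eq)
open Summit.QuantumFields.YangMills.Theorems.Prop7SectET3DeltaPiPInv (DeltaPiSlotP DeltaPiP_isSymmetric)
open Summit.QuantumFields.YangMills.Theorems.Prop7SectET3RealityPInv (DeltaPiSlotP_toL2_star_of_regPr trace_DeltaPiSlotP_toL2_eq_zero_of_regPr)

variable (F : T3Family) (n K : ℕ) (c₀ : ℝ) [Fact (0 < c₀)]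
  (Δx : GaugeField (F.P K) 0 (Matrix.specialUnitaryGroup (Fin 2) ℂ) → (BondL2K ℂ 3 (periodsT3 F K) c₀ W₂ →ₗ[ℂ] BondL2K ℂ 3 (periodsT3 F K) c₀ W₂))
  (U₀ : GaugeField (F.P K) 0 (Matrix.specialUnitaryGroup (Fin 2) ℂ))

/-! ## §1 The reading of the current `Δ̃ Y` on the route's bonds -/

section Reading

variable {L η : ℝ} [Fact (0 < L)] [Fact (0 < η)] {lev₀ : Bond 3 (periodsT3 F K) → ℕ} {κ' : Type*} [Fintype κ']
  (lev₁ : κ' → ℕ) (Dc : (Bond 3 (periodsT3 F K) → Matrix (Fin 2) (Fin 2) ℂ) →ₗ[ℂ] (κ' → Matrix (Fin 2) (Fin 2) ℂ))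

omit [Fact (0 < c₀)] in
/-- Lit's `funEquiv⁻¹` of the underlying bond function of a (115)-field IS the cell's `toL2` of its reading `ι Y` on the route's bonds.
[cite: Balaban1985Variational, (115) p.294; Balaban1985BackgroundPropagators, (3.11) p.392] -/
theorem funEquiv_symm_flat115_eq_toL2 (Y : Space115 L η lev₀ lev₁ Dc) :
    (funEquiv frobEquiv (fun _ : Bond 3 (periodsT3 F K) => c₀)).symm (flat115 Y)
      = toL2 F K c₀ (fun b' : PBond (F.P K) 0 => JetSup.equiv _ _ _ Y (bondEquiv F K b')) := by
  apply (WL2.equiv ℂ (fun _ : Bond 3 (periodsT3 F K) => c₀) W₂).injective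
  funext p
  rw [funEquiv_symm_apply, toL2_apply, flat115_apply, Equiv.apply_symm_apply]

omit [Fact (0 < c₀)] in
/-- **THE READING**: the bond value of `Δ̃ Y = currentCLM frobEquiv lev₁ Dc (Δx U₀) Y` at `b` is the route-carrier field `toL2⁻¹ (Δx U₀ (toL2 (ι Y)))` at `bondEquiv⁻¹ b`.
[cite: Balaban1985Variational, (27) p.282, (115) p.294] -/
theorem equiv_currentCLM_slot (Y : Space115 L η lev₀ lev₁ Dc) (b : Bond 3 (periodsT3 F K)) :
    NegSup.equiv (levWeight L η lev₀ 3) (Matrix (Fin 2) (Fin 2) ℂ) (currentCLM frobEquiv lev₁ Dc (Δx U₀) Y) b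
      = (toL2 F K c₀).symm (Δx U₀ (toL2 F K c₀ (fun b' : PBond (F.P K) 0 => JetSup.equiv _ _ _ Y (bondEquiv F K b')))) ((bondEquiv F K).symm b) := by
  rw [equiv_currentCLM, funEquiv_symm_flat115_eq_toL2, toL2_symm_apply, Equiv.apply_symm_apply]

end Reading

/-! ## §2 ★ (63)-symmetry of the slot for lit's BILINEAR pairing, and the `hΔ` binder — generic -/

section Symmetry

/-- ★ **`(x, Δx y) = (y, Δx x)`** for lit's bilinear trace pairing `tpair frobEquiv τ` (norming `hφ`), for ANY slot that is Hilbert-symmetric (`hΔsymm`) and commutes with the conjugation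
(`hΔx`): `⟪σx, Δ y⟫ = ⟪Δ σx, y⟫ = ⟪σ Δ x, y⟫ = ⟪σ Δ x, σσy⟫ = ⟪σy, Δ x⟫` (✓`tpair_eq_inner_starW`, ✓`starW_frobEquiv_eq`, ✓`toL2_star_star`, ✓`inner_toL2_star`).
[cite: Balaban1985BackgroundPropagators, (3.11) p.392, (3.118)–(3.119) p.419] -/
theorem tpair_slot_comm (τ : Matrix (Fin 2) (Fin 2) ℂ →ₗ[ℂ] ℂ) (hφ : ∀ X Y : Matrix (Fin 2) (Fin 2) ℂ, ⟪frobEquiv.symm X, frobEquiv.symm Y⟫_ℂ = τ (star X * Y))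
    (hΔsymm : (Δx U₀).IsSymmetric)
    (hΔx : ∀ f : BondL2K ℂ 3 (periodsT3 F K) c₀ W₂, Δx U₀ (toL2 F K c₀ (star ((toL2 F K c₀).symm f))) = toL2 F K c₀ (star ((toL2 F K c₀).symm (Δx U₀ f))))
    (x y : BondL2K ℂ 3 (periodsT3 F K) c₀ W₂) :
    tpair frobEquiv τ x (Δx U₀ y) = tpair frobEquiv τ y (Δx U₀ x) := by
  have ex : ∀ f g : BondL2K ℂ 3 (periodsT3 F K) c₀ W₂, tpair frobEquiv τ f g = ⟪toL2 F K c₀ (star ((toL2 F K c₀).symm f)), g⟫_ℂ := fun f g => by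
    rw [tpair_eq_inner_starW frobEquiv τ hφ f g, starW_frobEquiv_eq F K c₀ f]
  rw [ex, ex]
  calc ⟪toL2 F K c₀ (star ((toL2 F K c₀).symm x)), Δx U₀ y⟫_ℂ
      = ⟪Δx U₀ (toL2 F K c₀ (star ((toL2 F K c₀).symm x))), y⟫_ℂ := (hΔsymm _ _).symm
    _ = ⟪toL2 F K c₀ (star ((toL2 F K c₀).symm (Δx U₀ x))), y⟫_ℂ := by rw [hΔx]
    _ = ⟪toL2 F K c₀ (star ((toL2 F K c₀).symm (Δx U₀ x))), toL2 F K c₀ (star ((toL2 F K c₀).symm (toL2 F K c₀ (star ((toL2 F K c₀).symm y)))))⟫_ℂ := by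
          rw [toL2_star_star]
    _ = ⟪toL2 F K c₀ (star ((toL2 F K c₀).symm y)), Δx U₀ x⟫_ℂ := inner_toL2_star _ _

variable {L η : ℝ} [Fact (0 < L)] [Fact (0 < η)] {lev₀ : Bond 3 (periodsT3 F K) → ℕ} {κ' : Type*} [Fintype κ']
  (lev₁ : κ' → ℕ) (Dc : (Bond 3 (periodsT3 F K) → Matrix (Fin 2) (Fin 2) ℂ) →ₗ[ℂ] (κ' → Matrix (Fin 2) (Fin 2) ℂ))

/-- ★★ **THE `hΔ` BINDER OF ✓`pair27_W80_zpow` FOR `Δ̃ := currentCLM frobEquiv lev₁ Dc (Δx U₀)`, GENERIC IN THE SLOT**: `pair27 τ (Δ̃ Y) (flat115 Z) = pair27 τ (Δ̃ Z) (flat115 Y)` for a tracial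
`τ` with the norming `hφ`, given `hΔsymm`, `hΔx` (lit ✓`pairSum_currentCLM_comm` + `tpair_slot_comm`). [cite: Balaban1985Variational, (27) p.282, (80) p.290, (63) p.287] -/
theorem hΔ_currentCLM_slot (τ : Matrix (Fin 2) (Fin 2) ℂ →L[ℂ] ℂ) (hτ₂ : ∀ X Y : Matrix (Fin 2) (Fin 2) ℂ, τ (X * Y) = τ (Y * X))
    (hφ : ∀ X Y : Matrix (Fin 2) (Fin 2) ℂ, ⟪frobEquiv.symm X, frobEquiv.symm Y⟫_ℂ = τ (star X * Y))
    (hΔsymm : (Δx U₀).IsSymmetric)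
    (hΔx : ∀ f : BondL2K ℂ 3 (periodsT3 F K) c₀ W₂, Δx U₀ (toL2 F K c₀ (star ((toL2 F K c₀).symm f))) = toL2 F K c₀ (star ((toL2 F K c₀).symm (Δx U₀ f))))
    (Y Z : Space115 L η lev₀ lev₁ Dc) :
    pair27 τ (currentCLM frobEquiv lev₁ Dc (Δx U₀) Y) (flat115 Z) = pair27 τ (currentCLM frobEquiv lev₁ Dc (Δx U₀) Z) (flat115 Y) := by
  rw [pair27_eq_sum, pair27_eq_sum]
  exact pairSum_currentCLM_comm frobEquiv (τ : Matrix (Fin 2) (Fin 2) ℂ →ₗ[ℂ] ℂ) lev₁ Dc hτ₂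
    (tpair_slot_comm F K c₀ Δx U₀ (τ : Matrix (Fin 2) (Fin 2) ℂ →ₗ[ℂ] ℂ) hφ hΔsymm hΔx) Y Z

end Symmetry

/-! ## §3 ★ The (R-W) sector row — Hermitian traceless in, Hermitian traceless out — generic -/

section Sector

omit [Fact (0 < c₀)] in
/-- ★ **THE ROUTE-CARRIER FIELD `toL2⁻¹ (Δx U₀ (toL2 A))` IS HERMITIAN AND TRACELESS BONDWISE WHEN `A` IS**, given the slot's σ-row `hΔx` and traceless row `hΔtr`.
[cite: Balaban1985BackgroundPropagators, p.393, (3.119) p.419; Balaban1985Variational, (51) p.286] -/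
theorem slot_toL2_isHermitian_traceless
    (hΔx : ∀ f : BondL2K ℂ 3 (periodsT3 F K) c₀ W₂, Δx U₀ (toL2 F K c₀ (star ((toL2 F K c₀).symm f))) = toL2 F K c₀ (star ((toL2 F K c₀).symm (Δx U₀ f))))
    (hΔtr : ∀ A : PBond (F.P K) 0 → Matrix (Fin 2) (Fin 2) ℂ, (∀ b, (A b).trace = 0) → ∀ b, ((toL2 F K c₀).symm (Δx U₀ (toL2 F K c₀ A)) b).trace = 0)
    (A : PBond (F.P K) 0 → Matrix (Fin 2) (Fin 2) ℂ) (hA : ∀ b', (A b').IsHermitian ∧ (A b').trace = 0) (b' : PBond (F.P K) 0) :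
    ((toL2 F K c₀).symm (Δx U₀ (toL2 F K c₀ A)) b').IsHermitian ∧ ((toL2 F K c₀).symm (Δx U₀ (toL2 F K c₀ A)) b').trace = 0 := by
  refine ⟨?_, hΔtr A (fun b => (hA b).2) b'⟩
  have hAstar : star A = A := funext fun b => by rw [Pi.star_apply, Matrix.star_eq_conjTranspose, (hA b).1.eq]
  have hAstar' : star ((toL2 F K c₀).symm (toL2 F K c₀ A)) = A := by rw [LinearEquiv.symm_apply_apply, hAstar]
  have hstar' : Δx U₀ (toL2 F K c₀ A) = toL2 F K c₀ (star ((toL2 F K c₀).symm (Δx U₀ (toL2 F K c₀ A)))) := by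
    simpa only [hAstar'] using hΔx (toL2 F K c₀ A)
  have hB : (toL2 F K c₀).symm (Δx U₀ (toL2 F K c₀ A)) = star ((toL2 F K c₀).symm (Δx U₀ (toL2 F K c₀ A))) := by
    have hB' := congrArg (toL2 F K c₀).symm hstar'
    simpa only [LinearEquiv.symm_apply_apply] using hB'
  have hb := congrFun hB b'
  rw [Pi.star_apply, Matrix.star_eq_conjTranspose] at hb
  exact hb.symm

variable {L η : ℝ} [Fact (0 < L)] [Fact (0 < η)] {lev₀ : Bond 3 (periodsT3 F K) → ℕ} {κ' : Type*} [Fintype κ']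
  (lev₁ : κ' → ℕ) (Dc : (Bond 3 (periodsT3 F K) → Matrix (Fin 2) (Fin 2) ℂ) →ₗ[ℂ] (κ' → Matrix (Fin 2) (Fin 2) ℂ))

omit [Fact (0 < c₀)] in
/-- ★★ **THE (R-W) SECTOR ROW OF `Δ̃ := currentCLM frobEquiv lev₁ Dc (Δx U₀)` IN S9's `hWR` CURRENCY, GENERIC IN THE SLOT**: Hermitian traceless bond values in, Hermitian traceless bond values
out, given the slot's σ-row `hΔx` and traceless row `hΔtr`. [cite: Balaban1985Variational, (51) p.286, (84)–(89) pp.290–291; Balaban1985BackgroundPropagators, p.393] -/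
theorem currentCLM_slot_isHermitian_traceless
    (hΔx : ∀ f : BondL2K ℂ 3 (periodsT3 F K) c₀ W₂, Δx U₀ (toL2 F K c₀ (star ((toL2 F K c₀).symm f))) = toL2 F K c₀ (star ((toL2 F K c₀).symm (Δx U₀ f))))
    (hΔtr : ∀ A : PBond (F.P K) 0 → Matrix (Fin 2) (Fin 2) ℂ, (∀ b, (A b).trace = 0) → ∀ b, ((toL2 F K c₀).symm (Δx U₀ (toL2 F K c₀ A)) b).trace = 0)
    (Y : Space115 L η lev₀ lev₁ Dc) (hY : ∀ b, (JetSup.equiv _ _ _ Y b).IsHermitian ∧ (JetSup.equiv _ _ _ Y b).trace = 0) (b : Bond 3 (periodsT3 F K)) :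
    (NegSup.equiv (levWeight L η lev₀ 3) (Matrix (Fin 2) (Fin 2) ℂ) (currentCLM frobEquiv lev₁ Dc (Δx U₀) Y) b).IsHermitian ∧
      (NegSup.equiv (levWeight L η lev₀ 3) (Matrix (Fin 2) (Fin 2) ℂ) (currentCLM frobEquiv lev₁ Dc (Δx U₀) Y) b).trace = 0 := by
  rw [equiv_currentCLM_slot]
  exact slot_toL2_isHermitian_traceless F K c₀ Δx U₀ hΔx hΔtr _ (fun b' => hY _) _

omit [Fact (0 < c₀)] in
/-- ★ **lit ✓`W80_apply_mem`'s `hΔπ` BINDER VERBATIM at `Δπ := Δ̃`**, for any `ℝ`-submodule `S` of `M₂(ℂ)` characterised by «Hermitian ∧ traceless», generic in the slot.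
[cite: Balaban1985Variational, (51) p.286; Balaban1985BackgroundPropagators, p.393] -/
theorem currentCLM_slot_mem
    (hΔx : ∀ f : BondL2K ℂ 3 (periodsT3 F K) c₀ W₂, Δx U₀ (toL2 F K c₀ (star ((toL2 F K c₀).symm f))) = toL2 F K c₀ (star ((toL2 F K c₀).symm (Δx U₀ f))))
    (hΔtr : ∀ A : PBond (F.P K) 0 → Matrix (Fin 2) (Fin 2) ℂ, (∀ b, (A b).trace = 0) → ∀ b, ((toL2 F K c₀).symm (Δx U₀ (toL2 F K c₀ A)) b).trace = 0)
    (S : Submodule ℝ (Matrix (Fin 2) (Fin 2) ℂ)) (hS : ∀ X : Matrix (Fin 2) (Fin 2) ℂ, X ∈ S ↔ X.IsHermitian ∧ X.trace = 0) :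
    ∀ Y : Space115 L η lev₀ lev₁ Dc, (∀ b, JetSup.equiv _ _ _ Y b ∈ S) →
      ∀ b, NegSup.equiv _ _ (currentCLM frobEquiv lev₁ Dc (Δx U₀) Y) b ∈ S := fun Y hY b =>
  (hS _).2 (currentCLM_slot_isHermitian_traceless F K c₀ Δx U₀ lev₁ Dc hΔx hΔtr Y (fun b => (hS _).1 (hY b)) b)

end Sector

/-! ## §4 Instances, one line each: `Δx := DeltaEtaSlot` (unconditional) and `Δx := DeltaPiSlot` (on `RegPr`, no other row) -/

section Instances

variable (h : n ≤ K) (cB a : ℝ) [Fact (0 < cB)]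
  {L η : ℝ} [Fact (0 < L)] [Fact (0 < η)] {lev₀ : Bond 3 (periodsT3 F K) → ℕ} {κ' : Type*} [Fintype κ']
  (lev₁ : κ' → ℕ) (Dc : (Bond 3 (periodsT3 F K) → Matrix (Fin 2) (Fin 2) ℂ) →ₗ[ℂ] (κ' → Matrix (Fin 2) (Fin 2) ℂ))

omit [Fact (0 < cB)] in
/-- The σ-row of the slot `DeltaEtaSlot` (p01's ✓`DeltaEta_toL2_star`, read at `X := toL2⁻¹ f`). [cite: Balaban1985BackgroundPropagators, (3.10)–(3.12) p.392, p.393] -/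
theorem DeltaEtaSlot_toL2_star (f : BondL2K ℂ 3 (periodsT3 F K) c₀ W₂) :
    DeltaEtaSlot F n K c₀ U₀ (toL2 F K c₀ (star ((toL2 F K c₀).symm f))) = toL2 F K c₀ (star ((toL2 F K c₀).symm (DeltaEtaSlot F n K c₀ U₀ f))) := by
  have key := DeltaEta_toL2_star (F := F) (n := n) (K := K) (c₀ := c₀) U₀ ((toL2 F K c₀).symm f)
  rw [LinearEquiv.apply_symm_apply] at key
  rw [DeltaEtaSlot_apply, DeltaEtaSlot_apply]
  exact key

omit [Fact (0 < cB)] in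
/-- ★★ **`hΔ` AT `Δx := DeltaEtaSlot`, UNCONDITIONALLY** (every SU(2) background): `hΔsymm` ✓`DeltaEta_isSymmetric`, `hΔx` `DeltaEtaSlot_toL2_star`.
[cite: Balaban1985Variational, (80) p.290; Balaban1985BackgroundPropagators, (3.12) p.392] -/
theorem hΔ_currentCLM_DeltaEtaSlot (τ : Matrix (Fin 2) (Fin 2) ℂ →L[ℂ] ℂ) (hτ₂ : ∀ X Y : Matrix (Fin 2) (Fin 2) ℂ, τ (X * Y) = τ (Y * X))
    (hφ : ∀ X Y : Matrix (Fin 2) (Fin 2) ℂ, ⟪frobEquiv.symm X, frobEquiv.symm Y⟫_ℂ = τ (star X * Y)) (Y Z : Space115 L η lev₀ lev₁ Dc) :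
    pair27 τ (currentCLM frobEquiv lev₁ Dc (DeltaEtaSlot F n K c₀ U₀) Y) (flat115 Z) = pair27 τ (currentCLM frobEquiv lev₁ Dc (DeltaEtaSlot F n K c₀ U₀) Z) (flat115 Y) :=
  hΔ_currentCLM_slot F K c₀ (DeltaEtaSlot F n K c₀) U₀ lev₁ Dc τ hτ₂ hφ (fun x y => DeltaEta_isSymmetric U₀ x y)
    (DeltaEtaSlot_toL2_star F n K c₀ U₀) Y Z

omit [Fact (0 < cB)] in
/-- ★★ **THE (R-W) SECTOR ROW AT `Δx := DeltaEtaSlot`, UNCONDITIONALLY** (`hΔtr` ✓`trace_DeltaEta_toL2_eq_zero`). [cite: Balaban1985Variational, (51) p.286; Balaban1985BackgroundPropagators, p.393] -/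
theorem currentCLM_DeltaEtaSlot_isHermitian_traceless (Y : Space115 L η lev₀ lev₁ Dc)
    (hY : ∀ b, (JetSup.equiv _ _ _ Y b).IsHermitian ∧ (JetSup.equiv _ _ _ Y b).trace = 0) (b : Bond 3 (periodsT3 F K)) :
    (NegSup.equiv (levWeight L η lev₀ 3) (Matrix (Fin 2) (Fin 2) ℂ) (currentCLM frobEquiv lev₁ Dc (DeltaEtaSlot F n K c₀ U₀) Y) b).IsHermitian ∧
      (NegSup.equiv (levWeight L η lev₀ 3) (Matrix (Fin 2) (Fin 2) ℂ) (currentCLM frobEquiv lev₁ Dc (DeltaEtaSlot F n K c₀ U₀) Y) b).trace = 0 :=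
  currentCLM_slot_isHermitian_traceless F K c₀ (DeltaEtaSlot F n K c₀) U₀ lev₁ Dc (DeltaEtaSlot_toL2_star F n K c₀ U₀)
    (fun A hA b' => trace_DeltaEta_toL2_eq_zero U₀ A hA b') Y hY b

variable [Fact (0 < (F.L : ℝ))] [Fact (0 < ((F.L : ℝ)⁻¹) ^ (K - n))]

/-- **THE TWO SLOT ROWS OF `DeltaPiSlot` AT `U₀ ∈ 𝔘_k(ε₀)`** (windows `10⁹L²e ≤ 1`, `10¹²L³ε₀ ≤ 1`; NO other row): σ-row and traceless row, from the `Δ₁`-slot rows at `T_J := 0` (✓`DeltaOne_zero`) with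
the `QTwS` sectors ✓theorems at `RegPr`. [cite: Balaban1985BackgroundPropagators, (3.119) p.419, p.393, (3.14)] -/
theorem DeltaPiSlot_rows_of_regPr {ε₀ e : ℝ} (hε₀ : 0 < ε₀) (he : 0 < e) (hWe : 10 ^ 9 * (F.L : ℝ) ^ 2 * e ≤ 1) (hWε : 10 ^ 12 * (F.L : ℝ) ^ 3 * ε₀ ≤ 1)
    (hreg : RegPr F n K ε₀ U₀) :
    (∀ f : BondL2K ℂ 3 (periodsT3 F K) c₀ W₂,
        DeltaPiSlot F n K h c₀ cB a U₀ (toL2 F K c₀ (star ((toL2 F K c₀).symm f))) = toL2 F K c₀ (star ((toL2 F K c₀).symm (DeltaPiSlot F n K h c₀ cB a U₀ f)))) ∧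
    (∀ A : PBond (F.P K) 0 → Matrix (Fin 2) (Fin 2) ℂ, (∀ b, (A b).trace = 0) → ∀ b, ((toL2 F K c₀).symm (DeltaPiSlot F n K h c₀ cB a U₀ (toL2 F K c₀ A)) b).trace = 0) := by
  -- the J-term rows are trivial for `T_J := 0`
  have hT : ∀ f : BondL2K ℂ 3 (periodsT3 F K) c₀ W₂,
      (fun _ : GaugeField (F.P K) 0 (Matrix.specialUnitaryGroup (Fin 2) ℂ) => (0 : BondL2K ℂ 3 (periodsT3 F K) c₀ W₂ →ₗ[ℂ] BondL2K ℂ 3 (periodsT3 F K) c₀ W₂)) U₀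
          (toL2 F K c₀ (star ((toL2 F K c₀).symm f)))
        = toL2 F K c₀ (star ((toL2 F K c₀).symm ((fun _ : GaugeField (F.P K) 0 (Matrix.specialUnitaryGroup (Fin 2) ℂ) =>
            (0 : BondL2K ℂ 3 (periodsT3 F K) c₀ W₂ →ₗ[ℂ] BondL2K ℂ 3 (periodsT3 F K) c₀ W₂)) U₀ f))) := fun f => by
    simp only [LinearMap.zero_apply, map_zero, star_zero]
  have hTtr : ∀ A : PBond (F.P K) 0 → Matrix (Fin 2) (Fin 2) ℂ, (∀ b, (A b).trace = 0) →
      ∀ b, ((toL2 F K c₀).symm ((fun _ : GaugeField (F.P K) 0 (Matrix.specialUnitaryGroup (Fin 2) ℂ) =>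
        (0 : BondL2K ℂ 3 (periodsT3 F K) c₀ W₂ →ₗ[ℂ] BondL2K ℂ 3 (periodsT3 F K) c₀ W₂)) U₀ (toL2 F K c₀ A)) b).trace = 0 := fun A _ b => by
    simp only [LinearMap.zero_apply, map_zero, Pi.zero_apply, Matrix.trace_zero]
  have hTsymm : ((fun _ : GaugeField (F.P K) 0 (Matrix.specialUnitaryGroup (Fin 2) ℂ) =>
      (0 : BondL2K ℂ 3 (periodsT3 F K) c₀ W₂ →ₗ[ℂ] BondL2K ℂ 3 (periodsT3 F K) c₀ W₂)) U₀).IsSymmetric := fun x y => by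
    simp only [LinearMap.zero_apply, inner_zero_left, inner_zero_right]
  have hstar := DeltaOne_toL2_star_of_regPr F n K h c₀ cB a (fun _ => 0) U₀ hε₀ he hWe hWε hreg hT
  have htr := trace_DeltaOne_toL2_eq_zero_of_regPr F n K h c₀ cB a (fun _ => 0) U₀ hε₀ he hWe hWε hreg hTtr hTsymm
  rw [DeltaOne_zero] at hstar htr
  exact ⟨hstar, htr⟩

/-- ★★ **`hΔ` AT `Δx := DeltaPiSlot` ON `RegPr F n K ε₀ U₀`, NO OTHER ROW** (supersedes ✓p663055's `hΔ_currentCLM_DeltaPiSlot_of_regPr`, whose (Q-b)ʳ row `hscR` is superfluous — the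
UNCONDITIONAL ✓`QTwS_star_comm_of_regPr`). [cite: Balaban1985Variational, (80) p.290, (63) p.287; Balaban1985BackgroundPropagators, (3.119) p.419] -/
theorem hΔ_currentCLM_DeltaPiSlot_of_regPr' (τ : Matrix (Fin 2) (Fin 2) ℂ →L[ℂ] ℂ) (hτ₂ : ∀ X Y : Matrix (Fin 2) (Fin 2) ℂ, τ (X * Y) = τ (Y * X))
    (hφ : ∀ X Y : Matrix (Fin 2) (Fin 2) ℂ, ⟪frobEquiv.symm X, frobEquiv.symm Y⟫_ℂ = τ (star X * Y))
    {ε₀ e : ℝ} (hε₀ : 0 < ε₀) (he : 0 < e) (hWe : 10 ^ 9 * (F.L : ℝ) ^ 2 * e ≤ 1) (hWε : 10 ^ 12 * (F.L : ℝ) ^ 3 * ε₀ ≤ 1) (hreg : RegPr F n K ε₀ U₀)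
    (Y Z : Space115 L η lev₀ lev₁ Dc) :
    pair27 τ (currentCLM frobEquiv lev₁ Dc (DeltaPiSlot F n K h c₀ cB a U₀) Y) (flat115 Z)
      = pair27 τ (currentCLM frobEquiv lev₁ Dc (DeltaPiSlot F n K h c₀ cB a U₀) Z) (flat115 Y) :=
  hΔ_currentCLM_slot F K c₀ (DeltaPiSlot F n K h c₀ cB a) U₀ lev₁ Dc τ hτ₂ hφ
    (DeltaPiSlot_isSymmetric (F := F) (n := n) (K := K) (h := h) (c₀ := c₀) (cB := cB) (a := a) U₀)
    (DeltaPiSlot_rows_of_regPr F n K c₀ U₀ h cB a hε₀ he hWe hWε hreg).1 Y Z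

/-- ★★ **THE (R-W) SECTOR ROW AT `Δx := DeltaPiSlot` ON `RegPr F n K ε₀ U₀`, NO OTHER ROW** (S9's `hWR` currency; the (W-X′) `Δ̃π`).
[cite: Balaban1985Variational, (51) p.286; Balaban1985BackgroundPropagators, p.393, (3.119) p.419] -/
theorem currentCLM_DeltaPiSlot_isHermitian_traceless_of_regPr {ε₀ e : ℝ} (hε₀ : 0 < ε₀) (he : 0 < e) (hWe : 10 ^ 9 * (F.L : ℝ) ^ 2 * e ≤ 1)
    (hWε : 10 ^ 12 * (F.L : ℝ) ^ 3 * ε₀ ≤ 1) (hreg : RegPr F n K ε₀ U₀) (Y : Space115 L η lev₀ lev₁ Dc)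
    (hY : ∀ b, (JetSup.equiv _ _ _ Y b).IsHermitian ∧ (JetSup.equiv _ _ _ Y b).trace = 0) (b : Bond 3 (periodsT3 F K)) :
    (NegSup.equiv (levWeight L η lev₀ 3) (Matrix (Fin 2) (Fin 2) ℂ) (currentCLM frobEquiv lev₁ Dc (DeltaPiSlot F n K h c₀ cB a U₀) Y) b).IsHermitian ∧
      (NegSup.equiv (levWeight L η lev₀ 3) (Matrix (Fin 2) (Fin 2) ℂ) (currentCLM frobEquiv lev₁ Dc (DeltaPiSlot F n K h c₀ cB a U₀) Y) b).trace = 0 :=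
  currentCLM_slot_isHermitian_traceless F K c₀ (DeltaPiSlot F n K h c₀ cB a) U₀ lev₁ Dc (DeltaPiSlot_rows_of_regPr F n K c₀ U₀ h cB a hε₀ he hWe hWε hreg).1
    (DeltaPiSlot_rows_of_regPr F n K c₀ U₀ h cB a hε₀ he hWe hWε hreg).2 Y hY b

end Instances

/-! ## §5 ★★★ Instances at THE PINV SLOT OF RECORD `Δx := DeltaPiSlotP` (the flipped (W-X′) `Δ̃π`), on `RegPr`, `0 ≤ a`, no other row -/

section PInv

variable (h : n ≤ K) (cB a : ℝ) [Fact (0 < cB)] [Fact (0 < (F.L : ℝ))] [Fact (0 < ((F.L : ℝ)⁻¹) ^ (K - n))]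
  {L η : ℝ} [Fact (0 < L)] [Fact (0 < η)] {lev₀ : Bond 3 (periodsT3 F K) → ℕ} {κ' : Type*} [Fintype κ']
  (lev₁ : κ' → ℕ) (Dc : (Bond 3 (periodsT3 F K) → Matrix (Fin 2) (Fin 2) ℂ) →ₗ[ℂ] (κ' → Matrix (Fin 2) (Fin 2) ℂ))

/-- ★★★ **THE `hΔ` BINDER OF ✓`pair27_W80_zpow` AT THE PINV SLOT OF RECORD**: for `Δ̃π := currentCLM frobEquiv lev₁ Dc (DeltaPiSlotP F n K h c₀ cB a U₀)`, at `U₀ ∈ 𝔘_k(ε₀)` (windows `10⁹L²e ≤ 1`,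
`10¹²L³ε₀ ≤ 1`), `0 ≤ a`, every `L η lev₀ lev₁ κ′ Dc`: `pair27 τ (Δ̃π Y) (flat115 Z) = pair27 τ (Δ̃π Z) (flat115 Y)` — §2 with ✓`DeltaPiP_isSymmetric` and ★px3's ✓`DeltaPiSlotP_toL2_star_of_regPr`.
[cite: Balaban1985Variational, (27) p.282, (80) p.290, (63) p.287; Balaban1985BackgroundPropagators, (3.119) p.419] -/
theorem hΔ_currentCLM_DeltaPiSlotP_of_regPr (ha : 0 ≤ a) (τ : Matrix (Fin 2) (Fin 2) ℂ →L[ℂ] ℂ) (hτ₂ : ∀ X Y : Matrix (Fin 2) (Fin 2) ℂ, τ (X * Y) = τ (Y * X))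
    (hφ : ∀ X Y : Matrix (Fin 2) (Fin 2) ℂ, ⟪frobEquiv.symm X, frobEquiv.symm Y⟫_ℂ = τ (star X * Y))
    {ε₀ e : ℝ} (hε₀ : 0 < ε₀) (he : 0 < e) (hWe : 10 ^ 9 * (F.L : ℝ) ^ 2 * e ≤ 1) (hWε : 10 ^ 12 * (F.L : ℝ) ^ 3 * ε₀ ≤ 1) (hreg : RegPr F n K ε₀ U₀)
    (Y Z : Space115 L η lev₀ lev₁ Dc) :
    pair27 τ (currentCLM frobEquiv lev₁ Dc (DeltaPiSlotP F n K h c₀ cB a U₀) Y) (flat115 Z)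
      = pair27 τ (currentCLM frobEquiv lev₁ Dc (DeltaPiSlotP F n K h c₀ cB a U₀) Z) (flat115 Y) :=
  hΔ_currentCLM_slot F K c₀ (DeltaPiSlotP F n K h c₀ cB a) U₀ lev₁ Dc τ hτ₂ hφ (fun x y => DeltaPiP_isSymmetric U₀ x y)
    (DeltaPiSlotP_toL2_star_of_regPr F n K h c₀ cB a U₀ ha hε₀ he hWe hWε hreg) Y Z

/-- ★★★ **THE (R-W) SECTOR ROW AT THE PINV SLOT OF RECORD** (S9′'s `hWR` currency; lit ✓`W80_apply_mem`'s `hΔπ` letter row for the flipped `Δ̃π`): Hermitian traceless bond values in,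
Hermitian traceless bond values out — §3 with ★px3's ✓`DeltaPiSlotP_toL2_star_of_regPr`∕✓`trace_DeltaPiSlotP_toL2_eq_zero_of_regPr`.
[cite: Balaban1985Variational, (51) p.286, (84)–(89) pp.290–291; Balaban1985BackgroundPropagators, p.393, (3.119) p.419] -/
theorem currentCLM_DeltaPiSlotP_isHermitian_traceless_of_regPr (ha : 0 ≤ a) {ε₀ e : ℝ} (hε₀ : 0 < ε₀) (he : 0 < e)
    (hWe : 10 ^ 9 * (F.L : ℝ) ^ 2 * e ≤ 1) (hWε : 10 ^ 12 * (F.L : ℝ) ^ 3 * ε₀ ≤ 1) (hreg : RegPr F n K ε₀ U₀) (Y : Space115 L η lev₀ lev₁ Dc)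
    (hY : ∀ b, (JetSup.equiv _ _ _ Y b).IsHermitian ∧ (JetSup.equiv _ _ _ Y b).trace = 0) (b : Bond 3 (periodsT3 F K)) :
    (NegSup.equiv (levWeight L η lev₀ 3) (Matrix (Fin 2) (Fin 2) ℂ) (currentCLM frobEquiv lev₁ Dc (DeltaPiSlotP F n K h c₀ cB a U₀) Y) b).IsHermitian ∧
      (NegSup.equiv (levWeight L η lev₀ 3) (Matrix (Fin 2) (Fin 2) ℂ) (currentCLM frobEquiv lev₁ Dc (DeltaPiSlotP F n K h c₀ cB a U₀) Y) b).trace = 0 :=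
  currentCLM_slot_isHermitian_traceless F K c₀ (DeltaPiSlotP F n K h c₀ cB a) U₀ lev₁ Dc (DeltaPiSlotP_toL2_star_of_regPr F n K h c₀ cB a U₀ ha hε₀ he hWe hWε hreg)
    (trace_DeltaPiSlotP_toL2_eq_zero_of_regPr F n K h c₀ cB a U₀ ha hε₀ he hWe hWε hreg) Y hY b

end PInv

end Summit.QuantumFields.YangMills.Theorems.Prop7SectET3SlotCurrentRows

end
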